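import Summits.QuantumAdvantage.QuantumAdvantage.Theorems.CubicForrelationNearExactIsExactEightDigits

/-!
# Crux `CubicForrelation.NearExactIsExact` (stmt-QuantumAdvantage-14043) — the mixed-digit Walsh tower on 14 bits

Certificate seat `b2b-cforr-cert` (gen 4).  HONEST FRAMING: theorems about cubic Boolean functions on 14 bits (the finite slice `n = 14`
of the crux; input to the two-sided exclusion of the boundary value `Φ = 31/32` there) — NOT summit progress.

For a CUBIC `g : 𝔽₂¹⁴ → 𝔽₂` every Walsh value is a multiple of `32 = 2^{⌈14/3⌉}` (Ax/McEliece, the landed `tw_base`): `W_g = 32·u`.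
Writing the Euclidean digits `d₀ = u mod 2`, `d₁ = ⌊u/2⌋ mod 2`, `d₂ = ⌊u/4⌋ mod 2`: `d₀` is CONSTANT (`fd_digitZero` / `fd_parity_const`:
every cubic on 14 bits is of type O, `W ≡ 32 (mod 64)` everywhere, or even, `W ∈ 64ℤ`), `d₁` has algebraic degree `≤ 2` (`fd_digitOne`)
and `d₂` degree `≤ 4` (`fd_digitTwo`) — the landed 8-bit mixed-digit lemma (`ed_digitOne`, `ed_digitTwo`) moved SIX BITS UP: the cube-sum
exponents `|I| + ⌈(14 − |I|)/3⌉ − 5` coincide with `|I| + ⌈(8 − |I|)/3⌉ − 3`, so the proofs are the same (Poisson over `E_I`, Ax on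
`E_{Iᶜ}`: `32·Σ_{E_I} u = 2^{|I|}·2^{⌈(14−|I|)/3⌉}·z`; Ax for the lower digits; Möbius).  Numerical sanity check (seat folder
`work/c/check14.c`): degrees `0, ≤ 2, ≤ 4` on random cubics, the bounds `2, 4` attained.

References: J. Ax, Amer. J. Math. 86 (1964); R. J. McEliece, Discrete Math. 3 (1972); C. Carlet, *Boolean Functions for Cryptography and
Coding Theory*, CUP 2021, §2.2 and §4.1.  Everything below is proved from Mathlib and the tree; axioms are the standard three.
-/

set_option linter.dupNamespace false -- D-0017: single-problem summit ⇒ `QuantumAdvantage.QuantumAdvantage` by design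

noncomputable section

namespace Summit.QuantumAdvantage.QuantumAdvantage.Theorems.CubicForrelation.NearExactIsExact

open Finset
open Literature.Computability.QuantumComplexity
open Literature.Computability.QuantumComplexity.DerivativeWalsh (W)

/-! ### The cube sums of `u = W_g/32` and the three digits (n = 14) -/

/-- The cube sums of `u = W_g/32` for a cubic `g` on 14 bits: `32·Σ_{E_I} u = 2^{|I|}·2^{⌈(14−|I|)/3⌉}·z` (Poisson over `E_I`,
Ax on `E_{Iᶜ}`). [cite: Carlet2020, §4.1] -/
theorem fd_cube_sum (g : (Fin (7 + 7) → Bool) → Bool) (u : (Fin (7 + 7) → Bool) → ℤ) (hg : IsDegLeFun 3 g)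
    (hu : ∀ x, W (fun y => signOf (g y)) x = (2 : ℝ) ^ 5 * (u x : ℝ)) (I : Finset (Fin (7 + 7))) :
    ∃ z : ℤ, (2 : ℤ) ^ 5 * ∑ x ∈ {x : Fin (7 + 7) → Bool | ∀ i, x i = true → i ∈ I}, u x =
      2 ^ #I * (2 ^ ((7 + 7 - #I + 2) / 3) * z) := by
  have hP := bb_poisson (fun y => signOf (g y)) I
  obtain ⟨z, hz⟩ := stub_axParity (7 + 7) 3 g Iᶜ (by norm_num) hg
  have hj : #Iᶜ = 7 + 7 - #I := by rw [card_compl, Fintype.card_fin]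
  rw [hj, show (7 + 7 - #I + 3 - 1) / 3 = (7 + 7 - #I + 2) / 3 by omega] at hz
  rw [sum_congr rfl fun x _ => hu x, ← mul_sum, hz] at hP
  refine ⟨z, ?_⟩
  have h' : (((2 : ℤ) ^ 5 * ∑ x ∈ {x : Fin (7 + 7) → Bool | ∀ i, x i = true → i ∈ I}, u x : ℤ) : ℝ) =
      (((2 : ℤ) ^ #I * (2 ^ ((7 + 7 - #I + 2) / 3) * z) : ℤ) : ℝ) := by
    push_cast at hP ⊢
    linarith
  exact_mod_cast h'

/-- Divisibility read-out: if `2^5·S = 2^i·(2^c·z)` and `5 + e ≤ i + c` then `2^e ∣ S`. [folklore] -/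
theorem fd_dvd_of_balance {i c e : ℕ} {S z : ℤ} (hle : 5 + e ≤ i + c)
    (h : (2 : ℤ) ^ 5 * S = 2 ^ i * (2 ^ c * z)) : (2 : ℤ) ^ e ∣ S := by
  obtain ⟨r, hr⟩ : ∃ r, i + c = 5 + e + r := ⟨i + c - (5 + e), by omega⟩
  refine ⟨2 ^ r * z, ?_⟩
  have h0 : (2 : ℤ) ^ 5 ≠ 0 := by positivity
  apply mul_left_cancel₀ h0
  rw [h, ← mul_assoc, ← pow_add, hr, pow_add, pow_add]
  ring

/-- **Digit zero (the tower).** For cubic `g` on 14 bits with `W_g = 32·u`, the parity `[u odd]` is constant (degree `≤ 0`).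
[cite: Carlet2020, §4.1] -/
theorem fd_digitZero (g : (Fin (7 + 7) → Bool) → Bool) (u : (Fin (7 + 7) → Bool) → ℤ) (hg : IsDegLeFun 3 g)
    (hu : ∀ x, W (fun y => signOf (g y)) x = (2 : ℝ) ^ 5 * (u x : ℝ)) :
    IsDegLeFun 0 (fun x => decide (Odd (u x))) :=
  stub_walshTower stub_axParity (7 + 7) 5 0 g u hg hu (by intro k hk hkn; omega)

/-- The constant parity, pointwise: all values of `u = W_g/32` have the parity of `u(x₀)`. [folklore] -/
theorem fd_parity_const (g : (Fin (7 + 7) → Bool) → Bool) (u : (Fin (7 + 7) → Bool) → ℤ) (hg : IsDegLeFun 3 g)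
    (hu : ∀ x, W (fun y => signOf (g y)) x = (2 : ℝ) ^ 5 * (u x : ℝ)) (x x₀ : Fin (7 + 7) → Bool) :
    Odd (u x) ↔ Odd (u x₀) := by
  have h := tc_const_of_deg_zero (fd_digitZero g u hg hu) x x₀
  simpa only [decide_eq_decide] using h

/-- **Digit one.** For cubic `g` on 14 bits with `W_g = 32·u`, the Boolean function `x ↦ [⌊u(x)/2⌋ odd]` has algebraic degree
`≤ 2`. [this work; cite: Carlet2020, §4.1 for the divisibility input] -/
theorem fd_digitOne (g : (Fin (7 + 7) → Bool) → Bool) (u : (Fin (7 + 7) → Bool) → ℤ) (hg : IsDegLeFun 3 g)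
    (hu : ∀ x, W (fun y => signOf (g y)) x = (2 : ℝ) ^ 5 * (u x : ℝ)) :
    IsDegLeFun 2 (fun x => decide (Odd (u x / 2))) := by
  have hP0 := fd_digitZero g u hg hu
  refine bb_moebius_isDegLeFun 2 _ fun I hI => ?_
  have hk : #I ≤ 7 + 7 := (card_le_univ I).trans_eq (Fintype.card_fin _)
  obtain ⟨z, hz⟩ := fd_cube_sum g u hg hu I
  have h4 : (2 : ℤ) ^ 2 ∣ ∑ x ∈ {x : Fin (7 + 7) → Bool | ∀ i, x i = true → i ∈ I}, u x :=
    fd_dvd_of_balance (by omega) hz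
  obtain ⟨z', hz'⟩ := td_count_cube (le_refl 1) (fun x => decide (Odd (u x))) (hP0.mono (by norm_num)) I
  rw [show (#I + 1 - 1) / 1 = #I by simp] at hz'
  have hA : (4 : ℤ) ∣ #{x : Fin (7 + 7) → Bool | (∀ i, x i = true → i ∈ I) ∧ decide (Odd (u x)) = true} := by
    obtain ⟨e, he⟩ : ∃ e, #I = e + 3 := ⟨#I - 3, by omega⟩
    rw [he, show (2 : ℤ) ^ (e + 3) = 2 ^ e * 8 by rw [pow_add]; norm_num] at hz'
    exact ⟨2 ^ e * (1 - z'), by linarith⟩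
  have hsplit : ∑ x ∈ {x : Fin (7 + 7) → Bool | ∀ i, x i = true → i ∈ I}, u x =
      2 * ∑ x ∈ {x : Fin (7 + 7) → Bool | ∀ i, x i = true → i ∈ I}, u x / 2 +
        #{x : Fin (7 + 7) → Bool | (∀ i, x i = true → i ∈ I) ∧ decide (Odd (u x)) = true} := by
    rw [sum_congr rfl fun x _ => td_two_mul_div_add (u x), sum_add_distrib, ← mul_sum, td_sum_ite_odd, filter_filter]
    simp only [decide_eq_true_eq]
  have hE : Even (∑ x ∈ {x : Fin (7 + 7) → Bool | ∀ i, x i = true → i ∈ I}, u x / 2) := by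
    rw [pow_two] at h4
    obtain ⟨q, hq⟩ := h4
    obtain ⟨a, ha⟩ := hA
    exact ⟨q - a, by linarith⟩
  have hE' := (tw_even_sum_iff _ (fun x => u x / 2)).1 hE
  rw [filter_filter] at hE'
  simpa only [decide_eq_true_eq] using hE'

/-- **Digit two.** For cubic `g` on 14 bits with `W_g = 32·u`, the Boolean function `x ↦ [⌊⌊u(x)/2⌋/2⌋ odd]` has algebraic
degree `≤ 4`. [this work; cite: Carlet2020, §4.1 for the divisibility input] -/
theorem fd_digitTwo (g : (Fin (7 + 7) → Bool) → Bool) (u : (Fin (7 + 7) → Bool) → ℤ) (hg : IsDegLeFun 3 g)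
    (hu : ∀ x, W (fun y => signOf (g y)) x = (2 : ℝ) ^ 5 * (u x : ℝ)) :
    IsDegLeFun 4 (fun x => decide (Odd (u x / 2 / 2))) := by
  have hP0 := fd_digitZero g u hg hu
  have hP1 := fd_digitOne g u hg hu
  refine bb_moebius_isDegLeFun 4 _ fun I hI => ?_
  have hk : #I ≤ 7 + 7 := (card_le_univ I).trans_eq (Fintype.card_fin _)
  obtain ⟨z, hz⟩ := fd_cube_sum g u hg hu I
  have h8 : (2 : ℤ) ^ 3 ∣ ∑ x ∈ {x : Fin (7 + 7) → Bool | ∀ i, x i = true → i ∈ I}, u x :=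
    fd_dvd_of_balance (by omega) hz
  obtain ⟨z', hz'⟩ := td_count_cube (le_refl 1) (fun x => decide (Odd (u x))) (hP0.mono (by norm_num)) I
  rw [show (#I + 1 - 1) / 1 = #I by simp] at hz'
  have hA : (8 : ℤ) ∣ #{x : Fin (7 + 7) → Bool | (∀ i, x i = true → i ∈ I) ∧ decide (Odd (u x)) = true} := by
    obtain ⟨e, he⟩ : ∃ e, #I = e + 4 := ⟨#I - 4, by omega⟩
    rw [he, show (2 : ℤ) ^ (e + 4) = 2 ^ e * 16 by rw [pow_add]; norm_num] at hz'
    exact ⟨2 ^ e * (1 - z'), by linarith⟩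
  obtain ⟨z'', hz''⟩ := td_count_cube (by norm_num : 1 ≤ 2) (fun x => decide (Odd (u x / 2))) hP1 I
  have hB : (4 : ℤ) ∣ #{x : Fin (7 + 7) → Bool | (∀ i, x i = true → i ∈ I) ∧ decide (Odd (u x / 2)) = true} := by
    obtain ⟨e, he⟩ : ∃ e, #I = e + 5 := ⟨#I - 5, by omega⟩
    obtain ⟨e', he'⟩ : ∃ e', (#I + 2 - 1) / 2 = e' + 3 := ⟨(#I + 2 - 1) / 2 - 3, by omega⟩
    rw [he', he, show (2 : ℤ) ^ (e + 5) = 2 ^ e * 32 by rw [pow_add]; norm_num,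
      show (2 : ℤ) ^ (e' + 3) = 2 ^ e' * 8 by rw [pow_add]; norm_num] at hz''
    exact ⟨2 ^ e * 4 - 2 ^ e' * z'', by linarith⟩
  have hsplit : ∑ x ∈ {x : Fin (7 + 7) → Bool | ∀ i, x i = true → i ∈ I}, u x =
      2 * (2 * ∑ x ∈ {x : Fin (7 + 7) → Bool | ∀ i, x i = true → i ∈ I}, u x / 2 / 2 +
        #{x : Fin (7 + 7) → Bool | (∀ i, x i = true → i ∈ I) ∧ decide (Odd (u x / 2)) = true}) +
        #{x : Fin (7 + 7) → Bool | (∀ i, x i = true → i ∈ I) ∧ decide (Odd (u x)) = true} := by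
    rw [sum_congr rfl fun x _ => td_two_mul_div_add (u x), sum_add_distrib, ← mul_sum, td_sum_ite_odd, filter_filter,
      sum_congr rfl fun x _ => td_two_mul_div_add (u x / 2), sum_add_distrib, ← mul_sum, td_sum_ite_odd, filter_filter]
    simp only [decide_eq_true_eq]
  have hE : Even (∑ x ∈ {x : Fin (7 + 7) → Bool | ∀ i, x i = true → i ∈ I}, u x / 2 / 2) := by
    obtain ⟨q, hq⟩ := h8
    obtain ⟨a, ha⟩ := hA
    obtain ⟨b, hb⟩ := hB
    refine ⟨q - a - b, ?_⟩
    have := hsplit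
    rw [hq, ha, hb] at this
    linarith
  have hE' := (tw_even_sum_iff _ (fun x => u x / 2 / 2)).1 hE
  rw [filter_filter] at hE'
  simpa only [decide_eq_true_eq] using hE'

end Summit.QuantumAdvantage.QuantumAdvantage.Theorems.CubicForrelation.NearExactIsExact

end
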